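import Summits.QuantumFields.YangMills.Theorems.BalabanUVNodesN12AtRecord13SepCoPHSockets
import Summits.QuantumFields.YangMills.Theorems.BalabanUVNodesN12AtRecord13SepCoPHS
import Literature.MathematicalPhysics.QuantumFieldTheory.Balaban1983to89.Node00.Record13NumericsOfThm1CCM

/-!
# BalabanUVNodes ∕ N12 — N12's ROWS AND THE K1⁷ SOCKETS AT THE COLLARED K0⁷ WITNESS `θ₁₅ᶜᶜᴹ(jM) = theta13OfThm1CCM F N jM ε₀ ε₂₉ B₃ B₃' a₀ a₁` (dag-n21-c FILE A
# `Node00/Record13NumericsOfThm1CCM`, dag-lead WORDS-144∕145 pen (γ) «THE K0 WITNESS RE-PIN»: `ν.M₁ = τ9.M = L^{jM}`, everything else the unit branch's): the [IV] leaf from the per-run displays, the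
# whole-tower form, the `Λ`-pinned most-pinned row with `M = L^{jM}`, its non-vacuity certificate, the three term-constant signs, and the K1⁷ v5 rung body ∕ its N12 restriction at the door-cured pin
# (Track A, DAG node N12 = [B15, Balaban1989LargeFieldI] CMP **122** (1989) 175–202; cluster K1 — K1⁷ `StabilityBAtRecordR13SepCoPH` = stmt-QuantumFields-20542, helper, `--supports 20542`;
# seat `pub-ymgap-dag-n12-d` g13 (R134 s2 «knit at the record»), 2026-08-27; count-neutral, NOT a discharge)

HONEST FRAMING.  Count-neutral kernel INSTANTIATION BY NAME of this seat's generic-`Θ` rows and sockets (12E `…N12AtRecord13OfResiduals` §1, 14C `…N12AtRecord13TermPinned` §1, 12I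
`…N12AtRecord13TermPinnedLambda` §1, 12T-H `…N12AtRecord13SepCoPHSockets` §2, 12V-H `…N12AtRecord13SepCoPHS` §4 — every row a theorem of K0b's `HasResidualsOfRecord` at a live re-pin) AT
dag-n21-c's COLLARED WITNESS `θ₁₅ᶜᶜᴹ(jM)` (FILE A: `theta13OfThm1CCM F N jM ε₀ ε₂₉ B₃ B₃' a₀ a₁ := theta13LiveOfNumerics F N (stage12NumericsOfThm1CCM F.L jM ε₀ B₃ B₃' a₀ a₁) ε₂₉ …`, i.e.
`(theta13OfNumerics …).liveRepin₁₃` by `rfl`; K0b's residuals of record by K0a's `hasResidualsOfRecord_theta13OfNumerics`, admissibility by `admissible_theta13OfNumerics` at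
`stage12NumericsOfThm1CCM_pos` under `1 ≤ L` and the SIX witness signs `0 < ε₀`, `0 < ε₂₉`, `0 ≤ B₃`, `0 ≤ B₃′`, `0 < a₀`, `0 < a₁`) — the member at which the R-ROAD K0⁷ closers are stated
(dag-n07-e FILE 29 `Gauge9RegSepTopStepR … M c …` with the collar binder `c ≤ ν.M₁`; dag-n21-c FILE B `provisos₁₃SepCoP_theta13OfThm1CCM_of_thm1GaugeR`,
`exists_k0SepCoPH_of_thm1RegSepCoP7M_of_gauge9TopStepR_of_betaBox`; plan g75 V14 `stub_k0ROfStepTokensR13`), replacing the unit branch `θ₁₅ᶜᶜ¹` (`M = M₁ = 1`) as the witness of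
record.  The proofs are 12L's ∕ 12T-H §3's ∕ 12V-H §5's with the token swap `theta13OfThm1CC1 F N ε₀ … ↦ theta13OfThm1CCM F N jM ε₀ …`, `stage12NumericsOfThm1CC1 F.L … ↦
stage12NumericsOfThm1CCM F.L jM …`; the ONE content change is [IV]'s cube letter: `M` of record is now `L^{jM}`, so `0 < M` is discharged by `pow_pos` (`1 < L`) instead of `M = 1`, and the
printed residues `hN₀` ∕ `hMl` of the `Λ`-pinned row read `M = L^{jM}` (print p. 199 «M = L^{m₀}» is representable here).  Nothing of Bałaban's is asserted or proved; NO estimate; N12's per-run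
displays (the (1.100) pin equation, live-mass at level `kSel P + 1`, Proposition 1 (1.78), (1.80), (1.89) — or, at the `Λ`-pinned layer, their printed residues) stay DISPLAYED; the K1⁷-side
input of §4∕§5 is the v1.5 package `hP : Provisos₁₃SepCoP θ₁₅ᶜᶜᴹ(jM)` lifted through `.ofCured.ofHistoryBlind` (history-BLIND door image, FILE 27 §H1 one-way).  N12 is NOT discharged; no node is
discharged; counts unmoved (Track A discharged 5∕28); a re-pin is not progress.  ONE finite four-torus programme at fixed `ε = L^{-K}` — nothing continuum ∕ ℝ⁴ ∕ OS ∕ mass gap ∕ Clay.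

WHAT THIS FILE GIVES (all count-neutral):
* §1 ★★ `b15Leaf_WOfRecord₁₃_theta13OfThm1CCM_of_massLive` (N12's row at `θ₁₅ᶜᶜᴹ(jM)`, `kSel P < K`; ZERO K0-side hypotheses) and `…_all_of_massLive` (whole tower, the `K ≤ kSel P` leaf
  handed — the `h12` slot of dag-n24-c's view-form 7H∕8H sockets at this witness).
* §2 `new189_pinAllTHΛ_theta13OfThm1CCM_one_zero` (non-vacuity) and ★★★ `b15Leaf_WOfRecord₁₃_pinAllΛ_N0_theta13OfThm1CCM_of_massLive_of_flow` — N12's MOST-PINNED row at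
  `θ₁₅ᶜᶜᴹ(jM)` (letter of record `λᴧ`, dag-n12-e module 16), `M = L^{jM}`.
* §3 `kappa ∕ E0 ∕ B0_nonneg_theta13OfThm1CCM` (inputs of dag-n11-e's h-free N13 row; `θ₁₅ᶜᶜᴹ(jM).s2 = sect2NumericsOfThm1C F.L`).
* §4 ★★★ `nodesAtSomeRecordS₁₃SepCoPH_of_upS_fourPinW₀_ofHistoryBlind_ofCured_theta13OfThm1CCM_of_massLive` — the plan's v5 rung body `NodesAtSomeRecord13PWS` (at `N := 2`) at the
  door-cured collared witness, N12 (mixed W-pin, 12E) and N13 (dag-n11-e `laws₁₃CoPH_liveRepin₁₃_of_hasResiduals`) resolved; K1⁷-side input `hP : Provisos₁₃SepCoP θ₁₅ᶜᶜᴹ(jM)` alone.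
* §5 ★★★ `exists_guarded_recordS₁₃SepCoPH_b15_main_pinnedN12_ofHistoryBlind_ofCured_theta13OfThm1CCM_of_massLive` — the rung restricted to N12 (which-child-blocks line of N12).

Sources: [Balaban1989LargeFieldI] (0.2)–(0.6) p.176, (1.73) p.192, Prop. 1 (1.78) p.194, (1.80) p.195, (1.82) p.196, (1.88)–(1.90) pp.197–198, (1.99)–(1.102) pp.199–201;
[Balaban1989LargeFieldII] Thm 1 + (0.1) pp.355–356; [Balaban1988Convergent] (2.1)–(2.10) pp.254–256, (2.18) p.257, (3.16)–(3.25) pp.268–270; [Balaban1987RG1] (0.20) p.256, (1.12) p.262,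
(1.18) p.263; [Balaban1985RegularSpaces] (1.3)–(1.6) p.77, Prop. 6 p.99 (witness letter `M₁`); [Balaban1985Variational] Thm 1 p.279 (witness letters only).
-/

noncomputable section

open MeasureTheory
open scoped Matrix.Norms.L2Operator

namespace Summit.QuantumFields.YangMills.BalabanUVNodes.N12AtTheta13OfThm1CCM

open Literature.MathematicalPhysics.QuantumFieldTheory.Balaban1983to89
open Literature.MathematicalPhysics.QuantumFieldTheory.Balaban1983to89.T4Continuum (T4Family)
open Literature.MathematicalPhysics.QuantumFieldTheory.Balaban1983to89.DagBinding
open Literature.MathematicalPhysics.QuantumFieldTheory.Balaban1983to89.Node00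
open FlowStep (BetaLowerH BetaUpperH)
open FlowStepRuns (genFlow)
open B15Claim189Assembly (Setting189 new189 chiPP dom half)
open B15 (Prop1Printed Ineq180)
open B15.BasicStep (Claim189)
open B15.PrelimIntegrations (Ineq191 Ineq195)
open B15Chi124DetSets (E124)
open B15DeterminingSets (MSField)
open B14DomainGeom (Pt)
open B8Eq17ClassAkV1 (plaqsOf)
open GaugeGroup (dist1)
open GaugeField (plaqHol)
open B15Claim189PrintedConditions (omegaOfChain)
open B15Claim189PinsOfHistory (sitOfHist N0OfRecord₁₃ D189OfHist)
open B15Claim189LambdaPin (enlD)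
open B15RPrime1100OfRep (rPrimeDataOfSel)
open Summit.QuantumFields.YangMills.BalabanUVNodes.N12AtRecord13OfResiduals (b15Leaf_WOfRecord₁₃_theta13LiveOfNumerics_of_massLive
  b15Leaf_WOfRecord₁₃_liveRepin₁₃_all_of_massLive_of_hasResiduals)
open Summit.QuantumFields.YangMills.BalabanUVNodes.N12AtRecord13TermPinned (new189_pinAllTH_liveRepin₁₃_one_zero)
open Summit.QuantumFields.YangMills.BalabanUVNodes.N12AtRecord13TermPinnedLambda (b15Leaf_WOfRecord₁₃_pinAllΛ_N0_liveRepin₁₃_of_massLive_of_hasResiduals_of_flow)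
open Summit.QuantumFields.YangMills.BalabanUVNodes.N12AtRecord13SepCoPHSockets (nodesAtSomeRecordS₁₃SepCoPH_of_upS_fourPinW₀_ofHistoryBlind_ofCured_liveRepin₁₃_of_massLive_of_hasResiduals)
open Summit.QuantumFields.YangMills.BalabanUVNodes.N12AtRecord13SepCoPHS (exists_guarded_recordS₁₃SepCoPH_b15_main_pinnedN12_ofHistoryBlind_ofCured_liveRepin₁₃_of_massLive_of_hasResiduals)

variable {N : ℕ} [NeZero N] {F : T4Family}

/-! ## §1 N12's ROW AT `θ₁₅ᶜᶜᴹ(jM)` FROM ITS PER-RUN DISPLAYS — ZERO K0-SIDE HYPOTHESES -/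

section Leaf
variable (lam : ResidW F N)

variable (jM : ℕ) (ε₀ ε₂₉ B₃ B₃' a₀ a₁ : ℝ) in
/-- **★★ N12's ROW AT THE COLLARED K0⁷ WITNESS `θ₁₅ᶜᶜᴹ(jM) = theta13OfThm1CCM F N j ε₀ ε₂₉ B₃ B₃' a₀ a₁`** (dag-n21-c FILE A `Node00/Record13NumericsOfThm1CCM`, dag-lead WORDS-144∕145 pen (γ) «THE WITNESS RE-PIN»: the member of
node00-def-K0a's all-numerics live family at `stage12NumericsOfThm1CCM F.L jM …`, `ν.M₁ = τ9.M = L^{jM}`, on which the R-keyed K0⁷ closers are stated) — WITH ZERO K0-SIDE HYPOTHESES, not even the six witness signs (12E's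
numerics-generic ★★ `b15Leaf_WOfRecord₁₃_theta13LiveOfNumerics_of_massLive` at `n := stage12NumericsOfThm1CCM F.L jM ε₀ B₃ B₃' a₀ a₁`, `rfl`). [cite: Balaban1989LargeFieldI, (0.2)–(0.6) p.176, p.176 ll.14–16, Prop. 1 (1.78) p.194, (1.80) p.195, (1.89) p.198, (1.99)–(1.102) pp.200–201; Balaban1988Convergent, (3.16) p.268, (3.22)–(3.25) pp.269–270; Balaban1985RegularSpaces, (1.3)–(1.6) p.77 (witness letter `M₁ = L^{{jM}}` only); Balaban1985Variational, Thm 1 p.279 (witness letters only)] -/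
theorem b15Leaf_WOfRecord₁₃_theta13OfThm1CCM_of_massLive {P : B12.RunParams} (hk : lam.kSel P < P.K)
    (hpin : lam.D1100 P
      = rPrimeDataOfSel (reprTOfRecord₁₃ F N (theta13OfThm1CCM F N jM ε₀ ε₂₉ B₃ B₃' a₀ a₁) P (lam.kSel P))
          ((theta13OfThm1CCM F N jM ε₀ ε₂₉ B₃ B₃' a₀ a₁).ppSel P (gOfRecord₁₃ F N (theta13OfThm1CCM F N jM ε₀ ε₂₉ B₃ B₃' a₀ a₁) P) (lam.kSel P + 1))
          (fibOfSeq F (theta13OfThm1CCM F N jM ε₀ ε₂₉ B₃ B₃' a₀ a₁).ν (theta13OfThm1CCM F N jM ε₀ ε₂₉ B₃ B₃' a₀ a₁).τ9 P (gOfRecord₁₃ F N (theta13OfThm1CCM F N jM ε₀ ε₂₉ B₃ B₃' a₀ a₁) P) (lam.kSel P + 1)))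
    (hmassLive : ∀ s, LiveSeq F N (theta13OfThm1CCM F N jM ε₀ ε₂₉ B₃ B₃' a₀ a₁).ν (theta13OfThm1CCM F N jM ε₀ ε₂₉ B₃ B₃' a₀ a₁).τ9 P (gOfRecord₁₃ F N (theta13OfThm1CCM F N jM ε₀ ε₂₉ B₃ B₃' a₀ a₁) P) (lam.kSel P + 1)
        (slotsTOfRecord F N (theta13OfThm1CCM F N jM ε₀ ε₂₉ B₃ B₃' a₀ a₁).ν (theta13OfThm1CCM F N jM ε₀ ε₂₉ B₃ B₃' a₀ a₁).τ9 (EOfRecord₁₃ F N (theta13OfThm1CCM F N jM ε₀ ε₂₉ B₃ B₃' a₀ a₁)) (wOfRecord₉ F N (theta13OfThm1CCM F N jM ε₀ ε₂₉ B₃ B₃' a₀ a₁).toStage9Params)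
          (theta13OfThm1CCM F N jM ε₀ ε₂₉ B₃ B₃' a₀ a₁).ppSel P (gOfRecord₁₃ F N (theta13OfThm1CCM F N jM ε₀ ε₂₉ B₃ B₃' a₀ a₁) P) (lam.kSel P + 1)) s →
      0 < ∫ V, rterm (reprTOfRecord₁₃ F N (theta13OfThm1CCM F N jM ε₀ ε₂₉ B₃ B₃' a₀ a₁) P (lam.kSel P)) s V ∂(fieldMeasure (F.P P.K) (lam.kSel P + 1) (SU N)))
    (hP1 : Prop1Printed (lam.LF P))
    (h180 : ∀ U, new189 (lam.D189 P) U → ∀ i, (lam.D189 P).h ≤ i → i ≤ (lam.D189 P).k → ∀ q ∈ plaqsOf (dom (lam.D189 P) i),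
      Ineq180 ((lam.D189 P).dev0 U q) ((lam.D189 P).ε (lam.D189 P).k) (lam.D189 P).η (lam.D189 P).B₃ (lam.D189 P).B₅ (lam.D189 P).M (lam.D189 P).δ
        ((lam.D189 P).dist q) (lam.D189 P).O1)
    (h189 : Claim189 (new189 (lam.D189 P)) (chiPP (lam.D189 P))) : B15Leaf (WOfRecord₁₃ F N (theta13OfThm1CCM F N jM ε₀ ε₂₉ B₃ B₃' a₀ a₁) lam P) :=
  b15Leaf_WOfRecord₁₃_theta13LiveOfNumerics_of_massLive lam (stage12NumericsOfThm1CCM F.L jM ε₀ B₃ B₃' a₀ a₁) ε₂₉ hk hpin hmassLive hP1 h180 h189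

variable (jM : ℕ) (ε₀ ε₂₉ B₃ B₃' a₀ a₁ : ℝ) in
/-- **N12's ROW FOR THE WHOLE TOWER OF RUNS AT `θ₁₅ᶜᶜᴹ(jM)`, run by run, ZERO K0-SIDE HYPOTHESES** — the `h12` slot of the view-form four-pin Stage-13 sockets (dag-n24-c 7H∕8H) at the collared witness: below the
torus the pin equation + live-mass + Prop. 1 + (1.80) + (1.89); on runs with `K ≤ kSel P` the leaf HANDED (`hdeg` — no proviso clause of the record reaches a junk level; the mixed W-pin of §4∕§5 avoids it). [cite: Balaban1989LargeFieldI, (0.2)–(0.6) p.176, Prop. 1 (1.78) p.194, (1.80) p.195, (1.89) p.198, (1.99)–(1.102) pp.200–201 (bookkeeping)] -/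
theorem b15Leaf_WOfRecord₁₃_theta13OfThm1CCM_all_of_massLive
    (hdeg : ∀ P : B12.RunParams, P.K ≤ lam.kSel P → B15Leaf (WOfRecord₁₃ F N (theta13OfThm1CCM F N jM ε₀ ε₂₉ B₃ B₃' a₀ a₁) lam P))
    (hpin : ∀ P : B12.RunParams, lam.kSel P < P.K → lam.D1100 P
      = rPrimeDataOfSel (reprTOfRecord₁₃ F N (theta13OfThm1CCM F N jM ε₀ ε₂₉ B₃ B₃' a₀ a₁) P (lam.kSel P))
          ((theta13OfThm1CCM F N jM ε₀ ε₂₉ B₃ B₃' a₀ a₁).ppSel P (gOfRecord₁₃ F N (theta13OfThm1CCM F N jM ε₀ ε₂₉ B₃ B₃' a₀ a₁) P) (lam.kSel P + 1))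
          (fibOfSeq F (theta13OfThm1CCM F N jM ε₀ ε₂₉ B₃ B₃' a₀ a₁).ν (theta13OfThm1CCM F N jM ε₀ ε₂₉ B₃ B₃' a₀ a₁).τ9 P (gOfRecord₁₃ F N (theta13OfThm1CCM F N jM ε₀ ε₂₉ B₃ B₃' a₀ a₁) P) (lam.kSel P + 1)))
    (hmassLive : ∀ P : B12.RunParams, lam.kSel P < P.K → ∀ s, LiveSeq F N (theta13OfThm1CCM F N jM ε₀ ε₂₉ B₃ B₃' a₀ a₁).ν (theta13OfThm1CCM F N jM ε₀ ε₂₉ B₃ B₃' a₀ a₁).τ9 P (gOfRecord₁₃ F N (theta13OfThm1CCM F N jM ε₀ ε₂₉ B₃ B₃' a₀ a₁) P) (lam.kSel P + 1)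
        (slotsTOfRecord F N (theta13OfThm1CCM F N jM ε₀ ε₂₉ B₃ B₃' a₀ a₁).ν (theta13OfThm1CCM F N jM ε₀ ε₂₉ B₃ B₃' a₀ a₁).τ9 (EOfRecord₁₃ F N (theta13OfThm1CCM F N jM ε₀ ε₂₉ B₃ B₃' a₀ a₁)) (wOfRecord₉ F N (theta13OfThm1CCM F N jM ε₀ ε₂₉ B₃ B₃' a₀ a₁).toStage9Params)
          (theta13OfThm1CCM F N jM ε₀ ε₂₉ B₃ B₃' a₀ a₁).ppSel P (gOfRecord₁₃ F N (theta13OfThm1CCM F N jM ε₀ ε₂₉ B₃ B₃' a₀ a₁) P) (lam.kSel P + 1)) s →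
      0 < ∫ V, rterm (reprTOfRecord₁₃ F N (theta13OfThm1CCM F N jM ε₀ ε₂₉ B₃ B₃' a₀ a₁) P (lam.kSel P)) s V ∂(fieldMeasure (F.P P.K) (lam.kSel P + 1) (SU N)))
    (hP1 : ∀ P : B12.RunParams, lam.kSel P < P.K → Prop1Printed (lam.LF P))
    (h180 : ∀ P : B12.RunParams, lam.kSel P < P.K → ∀ U, new189 (lam.D189 P) U → ∀ i, (lam.D189 P).h ≤ i → i ≤ (lam.D189 P).k →
      ∀ q ∈ plaqsOf (dom (lam.D189 P) i),
        Ineq180 ((lam.D189 P).dev0 U q) ((lam.D189 P).ε (lam.D189 P).k) (lam.D189 P).η (lam.D189 P).B₃ (lam.D189 P).B₅ (lam.D189 P).M (lam.D189 P).δ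
          ((lam.D189 P).dist q) (lam.D189 P).O1)
    (h189 : ∀ P : B12.RunParams, lam.kSel P < P.K → Claim189 (new189 (lam.D189 P)) (chiPP (lam.D189 P))) :
    ∀ P : B12.RunParams, B15Leaf (WOfRecord₁₃ F N (theta13OfThm1CCM F N jM ε₀ ε₂₉ B₃ B₃' a₀ a₁) lam P) :=
  b15Leaf_WOfRecord₁₃_liveRepin₁₃_all_of_massLive_of_hasResiduals
    (theta13OfNumerics F N (stage12NumericsOfThm1CCM F.L jM ε₀ B₃ B₃' a₀ a₁) ε₂₉ (zeta316OfRecord F N (stage12NumericsOfThm1CCM F.L jM ε₀ B₃ B₃' a₀ a₁).ν (stage12NumericsOfThm1CCM F.L jM ε₀ B₃ B₃' a₀ a₁).τ9.M (stage12NumericsOfThm1CCM F.L jM ε₀ B₃ B₃' a₀ a₁).A₁) (RzOfRecord F N) (ZtOfRecord F N)) lam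
    (hasResidualsOfRecord_theta13OfNumerics F N (stage12NumericsOfThm1CCM F.L jM ε₀ B₃ B₃' a₀ a₁) ε₂₉) hdeg hpin hmassLive hP1 h180 h189

end Leaf

/-! ## §2 THE `Λ`-PINNED MOST-PINNED ROW AT `θ₁₅ᶜᶜᴹ(jM)` (letter of record `λᴧ := (λ.pinRPrime₁₃ θ₁₅ᶜᶜᴹ(jM)).pinD189ΛH …`, dag-n12-e module 16; `M = L^{jM}`) and its non-vacuity certificate -/

section Lambda
variable (jM : ℕ) (ε₀ ε₂₉ B₃ B₃' a₀ a₁ : ℝ) (lam : ResidW F N) (σ : ∀ P : B12.RunParams, Sit189 F N P.K)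
  (s : ∀ P : B12.RunParams, SeqOfRecord F (theta13OfThm1CCM F N jM ε₀ ε₂₉ B₃ B₃' a₀ a₁).ν (theta13OfThm1CCM F N jM ε₀ ε₂₉ B₃ B₃' a₀ a₁).τ9.M
    (gOfRecord₁₃ F N (theta13OfThm1CCM F N jM ε₀ ε₂₉ B₃ B₃' a₀ a₁) P) P.K (lam.kSel P + 1)) (Nm : B12.RunParams → ℕ) (p₁ : ℕ)

/-- **NON-VACUITY AT `θ₁₅ᶜᶜᴹ(jM)` FOR THE `Λ`-PINNED LAYER, ADMISSIBILITY FROM THE SIX WITNESS SIGNS** (14C's `new189_pinAllTH_liveRepin₁₃_one_zero` at the `Λ`-pinned family; dag-n21-c's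
`admissible_theta13OfThm1CCM`): on a run whose ₁₃ history lies in `]0, ½]` up to `n ≥ kSel P + 1`, with residual numbers `0 ≤ β < 1`, `0 < L₀`, `0 ≤ O(1)B₃B₅`, the (1.80) ∕ (1.89) antecedent `new189 (λᴧ.D189 P) (1, 0)`
HOLDS — §2's displays are not vacuous there. [cite: Balaban1989LargeFieldI, (1.82) p.196, (1.89) p.198; Balaban1988Convergent, (2.4) p.255, (2.10) p.256 (bookkeeping census)] -/
theorem new189_pinAllTHΛ_theta13OfThm1CCM_one_zero (hε : 0 < ε₀) (hε' : 0 < ε₂₉) (hB : 0 ≤ B₃) (hB' : 0 ≤ B₃') (ha₀ : 0 < a₀) (ha₁ : 0 < a₁)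
    (P : B12.RunParams) {n : ℕ} (hI : Step.InInterval (theta13OfThm1CCM F N jM ε₀ ε₂₉ B₃ B₃' a₀ a₁).γ n (gOfRecord₁₃ F N (theta13OfThm1CCM F N jM ε₀ ε₂₉ B₃ B₃' a₀ a₁) P))
    (hkn : lam.kSel P + 1 ≤ n) (hβ0 : 0 ≤ (σ P).β) (hβ1 : (σ P).β < 1) (hL₀ : 0 < (σ P).L₀) (hBB : 0 ≤ (σ P).O1 * (σ P).B₃ * (σ P).B₅) :
    new189 (((lam.pinRPrime₁₃ (theta13OfThm1CCM F N jM ε₀ ε₂₉ B₃ B₃' a₀ a₁)).pinD189ΛH (theta13OfThm1CCM F N jM ε₀ ε₂₉ B₃ B₃' a₀ a₁).ν (theta13OfThm1CCM F N jM ε₀ ε₂₉ B₃ B₃' a₀ a₁).A₁ (theta13OfThm1CCM F N jM ε₀ ε₂₉ B₃ B₃' a₀ a₁).τ9.M (gOfRecord₁₃ F N (theta13OfThm1CCM F N jM ε₀ ε₂₉ B₃ B₃' a₀ a₁)) σ s Nm p₁).D189 P)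
      ((1 : MSField (F.P P.K) (SU N)), fun _ _ => (0 : EuclideanSpace ℝ (Fin (N ^ 2 - 1)))) :=
  new189_pinAllTH_liveRepin₁₃_one_zero
    (theta13OfNumerics F N (stage12NumericsOfThm1CCM F.L jM ε₀ B₃ B₃' a₀ a₁) ε₂₉ (zeta316OfRecord F N (stage12NumericsOfThm1CCM F.L jM ε₀ B₃ B₃' a₀ a₁).ν (stage12NumericsOfThm1CCM F.L jM ε₀ B₃ B₃' a₀ a₁).τ9.M (stage12NumericsOfThm1CCM F.L jM ε₀ B₃ B₃' a₀ a₁).A₁) (RzOfRecord F N) (ZtOfRecord F N))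
    lam (fun P => ((((σ P).pinLambda (s P) (N0OfRecord₁₃ (theta13OfThm1CCM F N jM ε₀ ε₂₉ B₃ B₃' a₀ a₁) P (lam.kSel P + 1)) (enlD F (theta13OfThm1CCM F N jM ε₀ ε₂₉ B₃ B₃' a₀ a₁).ν (theta13OfThm1CCM F N jM ε₀ ε₂₉ B₃ B₃' a₀ a₁).τ9.M P (gOfRecord₁₃ F N (theta13OfThm1CCM F N jM ε₀ ε₂₉ B₃ B₃' a₀ a₁) P))).pinDistAt (lam.kSel P + 1)).pinZpp (s P) (N0OfRecord₁₃ (theta13OfThm1CCM F N jM ε₀ ε₂₉ B₃ B₃' a₀ a₁) P (lam.kSel P + 1)) (Nm P) (enlD F (theta13OfThm1CCM F N jM ε₀ ε₂₉ B₃ B₃' a₀ a₁).ν (theta13OfThm1CCM F N jM ε₀ ε₂₉ B₃ B₃' a₀ a₁).τ9.M P (gOfRecord₁₃ F N (theta13OfThm1CCM F N jM ε₀ ε₂₉ B₃ B₃' a₀ a₁) P))).pinCubes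
      (((((σ P).pinLambda (s P) (N0OfRecord₁₃ (theta13OfThm1CCM F N jM ε₀ ε₂₉ B₃ B₃' a₀ a₁) P (lam.kSel P + 1)) (enlD F (theta13OfThm1CCM F N jM ε₀ ε₂₉ B₃ B₃' a₀ a₁).ν (theta13OfThm1CCM F N jM ε₀ ε₂₉ B₃ B₃' a₀ a₁).τ9.M P (gOfRecord₁₃ F N (theta13OfThm1CCM F N jM ε₀ ε₂₉ B₃ B₃' a₀ a₁) P))).pinDistAt (lam.kSel P + 1)).pinZpp (s P) (N0OfRecord₁₃ (theta13OfThm1CCM F N jM ε₀ ε₂₉ B₃ B₃' a₀ a₁) P (lam.kSel P + 1)) (Nm P) (enlD F (theta13OfThm1CCM F N jM ε₀ ε₂₉ B₃ B₃' a₀ a₁).ν (theta13OfThm1CCM F N jM ε₀ ε₂₉ B₃ B₃' a₀ a₁).τ9.M P (gOfRecord₁₃ F N (theta13OfThm1CCM F N jM ε₀ ε₂₉ B₃ B₃' a₀ a₁) P))).OmTᶜ ∩ omegaOfChain (s P) (lam.kSel P + 1 - Nm P))) s Nm (fun P => N0OfRecord₁₃ (theta13OfThm1CCM F N jM ε₀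 ε₂₉ B₃ B₃' a₀ a₁) P (lam.kSel P + 1)) p₁
    (admissible_theta13OfThm1CCM F N hε hε' hB hB' ha₀ ha₁) P hI hkn hβ0 hβ1 hL₀ hBB

/-- **★★★ N12's MOST-PINNED ROW OF RECORD AT `θ₁₅ᶜᶜᴹ(jM)`: the `Λ`-, cube-, distance-, `Z″`- and `N₀`-pinned term-pinned bundle `WOfRecord₁₃ θ₁₅ᶜᶜᴹ(jM) λᴧ P`, `kSel P < K` — ZERO K0-SIDE HYPOTHESES, NO (1.89) DISPLAY,
NO LOCATED-GEOMETRY BINDER** (12I §1 at `Θ := theta13OfNumerics … (stage12NumericsOfThm1CCM …) …`, whose ₁₃ live re-pin IS `θ₁₅ᶜᶜᴹ(jM)`).  NEW AT THE COLLARED MEMBER: [IV]'s cube letter `M` of record is `L^{jM}` (not `1`):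
`0 < M` is discharged by `pow_pos` (`1 < L`), and the two printed «M large ∕ N₀» residues `hN₀` ∕ `hMl` now READ `M = L^{jM}` — print's p. 199 choice «M a power of L» is representable at this witness.  THE KERNEL's
LIST OF WHAT N12 COSTS PER RUN AT THE K0⁷ WITNESS OF RECORD = this hypothesis list (shape identical to 12I's ★★★ ∕ 12L's): live-mass at level `kSel P + 1` (NODE 00); Prop. 1 at `λ.LF P`; the levels; the situation's
residual numbers and print's two p. 200 conditions; the flow inputs; the coupling step; `Λ ≠ ∅`; the four ℍ-leaves and (1.80). [cite: Balaban1989LargeFieldI, (0.2)–(0.6) p.176, p.176 ll.14–16, (1.73) p.192, Prop. 1 (1.78) p.194, (1.80) p.195, (1.10)–(1.11) p.179, (1.88)–(1.90) pp.197–198, pp.199–201; Balaban1988Convergent, (2.1) p.254, (2.5)–(2.8) pp.255–256, (2.17) p.257, (3.16) p.268, (3.22)–(3.25) pp.269–270; Balaban1987RG1, (0.20) p.256, (1.12) p.262; Balaban1985Variational, Thm 1 p.279 (witness letters only)] -/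
theorem b15Leaf_WOfRecord₁₃_pinAllΛ_N0_theta13OfThm1CCM_of_massLive_of_flow
    {P : B12.RunParams} (hK : lam.kSel P < P.K) (hsh : 0 < (σ P).sh)
    {D : Setting189 (F.P P.K) (SU N) (MSField (F.P P.K) (SU N) × ((j : ℕ) → VecField (F.P P.K) j (EuclideanSpace ℝ (Fin (N ^ 2 - 1))))) (Pt (F.P P.K).d)}
    (hD : D = ((lam.pinRPrime₁₃ (theta13OfThm1CCM F N jM ε₀ ε₂₉ B₃ B₃' a₀ a₁)).pinD189ΛH (theta13OfThm1CCM F N jM ε₀ ε₂₉ B₃ B₃' a₀ a₁).ν (theta13OfThm1CCM F N jM ε₀ ε₂₉ B₃ B₃' a₀ a₁).A₁ (theta13OfThm1CCM F N jM ε₀ ε₂₉ B₃ B₃' a₀ a₁).τ9.M (gOfRecord₁₃ F N (theta13OfThm1CCM F N jM ε₀ ε₂₉ B₃ B₃' a₀ a₁)) σ s Nm p₁).D189 P)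
    (hmassLive : ∀ a, LiveSeq F N (theta13OfThm1CCM F N jM ε₀ ε₂₉ B₃ B₃' a₀ a₁).ν (theta13OfThm1CCM F N jM ε₀ ε₂₉ B₃ B₃' a₀ a₁).τ9 P (gOfRecord₁₃ F N (theta13OfThm1CCM F N jM ε₀ ε₂₉ B₃ B₃' a₀ a₁) P) (lam.kSel P + 1)
        (slotsTOfRecord F N (theta13OfThm1CCM F N jM ε₀ ε₂₉ B₃ B₃' a₀ a₁).ν (theta13OfThm1CCM F N jM ε₀ ε₂₉ B₃ B₃' a₀ a₁).τ9 (EOfRecord₁₃ F N (theta13OfThm1CCM F N jM ε₀ ε₂₉ B₃ B₃' a₀ a₁)) (wOfRecord₉ F N (theta13OfThm1CCM F N jM ε₀ ε₂₉ B₃ B₃' a₀ a₁).toStage9Params)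
          (theta13OfThm1CCM F N jM ε₀ ε₂₉ B₃ B₃' a₀ a₁).ppSel P (gOfRecord₁₃ F N (theta13OfThm1CCM F N jM ε₀ ε₂₉ B₃ B₃' a₀ a₁) P) (lam.kSel P + 1)) a →
      0 < ∫ V, rterm (reprTOfRecord₁₃ F N (theta13OfThm1CCM F N jM ε₀ ε₂₉ B₃ B₃' a₀ a₁) P (lam.kSel P)) a V ∂(fieldMeasure (F.P P.K) (lam.kSel P + 1) (SU N)))
    (hP1 : Prop1Printed (lam.LF P))
    (hlog : 1 < (Real.log (gOfRecord₁₃ F N (theta13OfThm1CCM F N jM ε₀ ε₂₉ B₃ B₃' a₀ a₁) P (lam.kSel P + 1) ^ 2)⁻¹) ^ (theta13OfThm1CCM F N jM ε₀ ε₂₉ B₃ B₃' a₀ a₁).ν.r)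
    (hNN : N0OfRecord₁₃ (theta13OfThm1CCM F N jM ε₀ ε₂₉ B₃ B₃' a₀ a₁) P (lam.kSel P + 1) ≤ Nm P) (hNk : N0OfRecord₁₃ (theta13OfThm1CCM F N jM ε₀ ε₂₉ B₃ B₃' a₀ a₁) P (lam.kSel P + 1) ≤ lam.kSel P + 1)
    (hβ0 : 0 ≤ (σ P).β) (hβ : (σ P).β ≤ 1 / 4) (hL₀ : 2 ≤ (σ P).L₀) (hL₀L : (σ P).L₀ ^ 2 ≤ ((F.P P.K).L : ℝ))
    (hB : 0 ≤ (σ P).O1 * (σ P).B₃ * (σ P).B₅) (hδ : 0 ≤ (σ P).δ)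
    (hN₀ : (2 + (121 / 120) ^ 2 * ((σ P).O1 * (σ P).B₃ * (σ P).B₅ * ((theta13OfThm1CCM F N jM ε₀ ε₂₉ B₃ B₃' a₀ a₁).τ9.M : ℝ) ^ 5)) *
      ((((σ P).L₀ ^ 2) ^ (N0OfRecord₁₃ (theta13OfThm1CCM F N jM ε₀ ε₂₉ B₃ B₃' a₀ a₁) P (lam.kSel P + 1) - 1))⁻¹) ≤ 1 / 4)
    (hMl : (121 / 120) ^ 2 * ((σ P).O1 * (σ P).B₃ * (σ P).B₅ * ((theta13OfThm1CCM F N jM ε₀ ε₂₉ B₃ B₃' a₀ a₁).τ9.M : ℝ) ^ 5) * Real.exp (-(4 * (σ P).δ * ((theta13OfThm1CCM F N jM ε₀ ε₂₉ B₃ B₃' a₀ a₁).τ9.M : ℝ))) ≤ 1 / 12)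
    (hε0 : ∀ i, lam.kSel P + 1 - Nm P ≤ i → i ≤ lam.kSel P + 1 → 0 ≤ epsOfRecord (theta13OfThm1CCM F N jM ε₀ ε₂₉ B₃ B₃' a₀ a₁).ν (gOfRecord₁₃ F N (theta13OfThm1CCM F N jM ε₀ ε₂₉ B₃ B₃' a₀ a₁) P) i)
    (hε1 : ∀ i, lam.kSel P + 1 - Nm P ≤ i → i ≤ lam.kSel P + 1 → epsOfRecord (theta13OfThm1CCM F N jM ε₀ ε₂₉ B₃ B₃' a₀ a₁).ν (gOfRecord₁₃ F N (theta13OfThm1CCM F N jM ε₀ ε₂₉ B₃ B₃' a₀ a₁) P) i ≤ 1 / 10)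
    {β₀ : ℝ} (hβ₀0 : 0 ≤ β₀) (hβ₀ : β₀ ≤ 1 / 2)
    (hflow : ∀ j, lam.kSel P + 1 - Nm P ≤ j → j < lam.kSel P + 1 → epsOfRecord (theta13OfThm1CCM F N jM ε₀ ε₂₉ B₃ B₃' a₀ a₁).ν (gOfRecord₁₃ F N (theta13OfThm1CCM F N jM ε₀ ε₂₉ B₃ B₃' a₀ a₁) P) (lam.kSel P + 1)
      ≤ (1 + β₀) * Real.sqrt ((lam.kSel P + 1 - j : ℕ) : ℝ) * epsOfRecord (theta13OfThm1CCM F N jM ε₀ ε₂₉ B₃ B₃' a₀ a₁).ν (gOfRecord₁₃ F N (theta13OfThm1CCM F N jM ε₀ ε₂₉ B₃ B₃' a₀ a₁) P) j)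
    -- the `N₀`-equation's one step of monotone couplings, and `Λ ≠ ∅` (a non-trivial 𝐑-step)
    (hgpos : 0 < (gOfRecord₁₃ F N (theta13OfThm1CCM F N jM ε₀ ε₂₉ B₃ B₃' a₀ a₁) P) (lam.kSel P + 1 + 1 - (N0OfRecord₁₃ (theta13OfThm1CCM F N jM ε₀ ε₂₉ B₃ B₃' a₀ a₁) P (lam.kSel P + 1))))
    (hgstep : (gOfRecord₁₃ F N (theta13OfThm1CCM F N jM ε₀ ε₂₉ B₃ B₃' a₀ a₁) P) (lam.kSel P + 1 + 1 - (N0OfRecord₁₃ (theta13OfThm1CCM F N jM ε₀ ε₂₉ B₃ B₃' a₀ a₁) P (lam.kSel P + 1))) ≤ (gOfRecord₁₃ F N (theta13OfThm1CCM F N jM ε₀ ε₂₉ B₃ B₃' a₀ a₁) P) (lam.kSel P + 1 + 2 - (N0OfRecord₁₃ (theta13OfThm1CCM F N jM ε₀ ε₂₉ B₃ B₃' a₀ a₁) P (lam.kSel P + 1))))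
    (hgle : (gOfRecord₁₃ F N (theta13OfThm1CCM F N jM ε₀ ε₂₉ B₃ B₃' a₀ a₁) P) (lam.kSel P + 1 + 2 - (N0OfRecord₁₃ (theta13OfThm1CCM F N jM ε₀ ε₂₉ B₃ B₃' a₀ a₁) P (lam.kSel P + 1))) ≤ 1)
    (hΛ : (((enlD F (theta13OfThm1CCM F N jM ε₀ ε₂₉ B₃ B₃' a₀ a₁).ν (theta13OfThm1CCM F N jM ε₀ ε₂₉ B₃ B₃' a₀ a₁).τ9.M P (gOfRecord₁₃ F N (theta13OfThm1CCM F N jM ε₀ ε₂₉ B₃ B₃' a₀ a₁) P)) 4 (lam.kSel P + 1 + 1 - (N0OfRecord₁₃ (theta13OfThm1CCM F N jM ε₀ ε₂₉ B₃ B₃' a₀ a₁) P (lam.kSel P + 1)))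
        (omegaOfChain (s P) (lam.kSel P + 1 + 1 - (N0OfRecord₁₃ (theta13OfThm1CCM F N jM ε₀ ε₂₉ B₃ B₃' a₀ a₁) P (lam.kSel P + 1)))))ᶜ ∩ (σ P).Z).Nonempty)
    (L91h : ∀ U, new189 D U → ∀ p ∈ plaqsOf (half D),
      Ineq191 (dist1 (plaqHol (D.Upp U) p)) (D.devV'' U p) D.α ((D.L ^ D.h)⁻¹) (D.ε D.h) (E124 D.ε D.L D.η D.k D.h))
    (L95 : ∀ U, new189 D U → ∀ p ∈ plaqsOf (half D),
      Ineq195 (D.devV'' U p) (dist1 (plaqHol (D.Uhalf U (D.boxOf p)) p)) D.α ((D.L ^ D.h)⁻¹) (D.ε D.h) (E124 D.ε D.L D.η D.k D.h))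
    (L91 : ∀ U, new189 D U → ∀ j, D.h ≤ j → j ≤ D.k → ∀ p ∈ plaqsOf (dom D j),
      Ineq191 (dist1 (plaqHol (D.Upp U) p)) (D.dev97 U p) D.α ((D.L ^ j)⁻¹) (D.ε j) (E124 D.ε D.L D.η D.k j))
    (L97 : ∀ U, new189 D U → ∀ j, D.h ≤ j → j ≤ D.k → ∀ p ∈ plaqsOf (dom D j),
      Ineq191 (D.dev97 U p) (D.dev0 U p) D.α ((D.L ^ j)⁻¹) (D.ε j) (E124 D.ε D.L D.η D.k j))
    (L80 : ∀ U, new189 D U → ∀ j, D.h ≤ j → j ≤ D.k → ∀ p ∈ plaqsOf (dom D j),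
      Ineq180 (D.dev0 U p) (D.ε D.k) D.η D.B₃ D.B₅ D.M D.δ (D.dist p) D.O1) :
    B15Leaf (WOfRecord₁₃ F N (theta13OfThm1CCM F N jM ε₀ ε₂₉ B₃ B₃' a₀ a₁)
      ((lam.pinRPrime₁₃ (theta13OfThm1CCM F N jM ε₀ ε₂₉ B₃ B₃' a₀ a₁)).pinD189ΛH (theta13OfThm1CCM F N jM ε₀ ε₂₉ B₃ B₃' a₀ a₁).ν (theta13OfThm1CCM F N jM ε₀ ε₂₉ B₃ B₃' a₀ a₁).A₁ (theta13OfThm1CCM F N jM ε₀ ε₂₉ B₃ B₃' a₀ a₁).τ9.M (gOfRecord₁₃ F N (theta13OfThm1CCM F N jM ε₀ ε₂₉ B₃ B₃' a₀ a₁)) σ s Nm p₁) P) :=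
  b15Leaf_WOfRecord₁₃_pinAllΛ_N0_liveRepin₁₃_of_massLive_of_hasResiduals_of_flow
    (theta13OfNumerics F N (stage12NumericsOfThm1CCM F.L jM ε₀ B₃ B₃' a₀ a₁) ε₂₉ (zeta316OfRecord F N (stage12NumericsOfThm1CCM F.L jM ε₀ B₃ B₃' a₀ a₁).ν (stage12NumericsOfThm1CCM F.L jM ε₀ B₃ B₃' a₀ a₁).τ9.M (stage12NumericsOfThm1CCM F.L jM ε₀ B₃ B₃' a₀ a₁).A₁) (RzOfRecord F N) (ZtOfRecord F N)) lam σ s Nm p₁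
    (hasResidualsOfRecord_theta13OfNumerics F N (stage12NumericsOfThm1CCM F.L jM ε₀ B₃ B₃' a₀ a₁) ε₂₉) hK hsh
    (pow_pos (Nat.zero_lt_of_lt F.hL.2) jM) -- `M` of record at `θ₁₅ᶜᶜᴹ(jM)` is `L ^ jM > 0` (dag-n21-c's `theta13OfThm1CCM_τ9_M`, `rfl`; `1 < L`): print's «M large» survives as the residual `hMl`
    hD hmassLive hP1 hlog hNN hNk hβ0 hβ hL₀ hL₀L hB hδ hN₀ hMl hε0 hε1 hβ₀0 hβ₀ hflow
    hgpos hgstep hgle hΛ L91h L95 L91 L97 L80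

end Lambda

/-! ## §3 THE THREE TERM-CONSTANT SIGNS AT `θ₁₅ᶜᶜᴹ(jM)` (inputs of dag-n11-e's h-free N13 (R₁₃) row; `θ₁₅ᶜᶜᴹ(jM).s2 = sect2NumericsOfThm1C F.L`) -/

section Signs

/-- `θ₁₅ᶜᶜᴹ(jM)`'s decay rate is `κ = 2·10⁴ ≥ 0` (dag-n21-c's `theta13OfThm1CCM_κ`; `θ₁₅ᶜᶜᴹ(jM).s2 = sect2NumericsOfThm1C F.L` — the §2 numerics of `θ₁₅ᶜ` ∕ `θ₁₅ᶜᶜ¹`, collar-blind). [cite: Balaban1987RG1, (1.18) p.263 (bookkeeping witness)] -/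
theorem kappa_nonneg_theta13OfThm1CCM (F : T4Family) (N : ℕ) [NeZero N] (jM : ℕ) (ε₀ ε₂₉ B₃ B₃' a₀ a₁ : ℝ) : 0 ≤ (theta13OfThm1CCM F N jM ε₀ ε₂₉ B₃ B₃' a₀ a₁).s2.lf.κ := by
  rw [theta13OfThm1CCM_κ]; norm_num

/-- `θ₁₅ᶜᶜᴹ(jM)`'s term constants have `E₀ = 1 ≥ 0` (`rfl`). [cite: Balaban1988Convergent, (2.31) p.260 (bookkeeping witness)] -/
theorem E0_nonneg_theta13OfThm1CCM (F : T4Family) (N : ℕ) [NeZero N] (jM : ℕ) (ε₀ ε₂₉ B₃ B₃' a₀ a₁ : ℝ) : 0 ≤ (theta13OfThm1CCM F N jM ε₀ ε₂₉ B₃ B₃' a₀ a₁).s2.lf.E₀ := by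
  have hE : (theta13OfThm1CCM F N jM ε₀ ε₂₉ B₃ B₃' a₀ a₁).s2.lf.E₀ = 1 := rfl
  rw [hE]; exact zero_le_one

/-- `θ₁₅ᶜᶜᴹ(jM)`'s term constants have `B₀ = 1 ≥ 0` (`rfl`). [cite: Balaban1988Convergent, (2.42) p.261 (bookkeeping witness)] -/
theorem B0_nonneg_theta13OfThm1CCM (F : T4Family) (N : ℕ) [NeZero N] (jM : ℕ) (ε₀ ε₂₉ B₃ B₃' a₀ a₁ : ℝ) : 0 ≤ (theta13OfThm1CCM F N jM ε₀ ε₂₉ B₃ B₃' a₀ a₁).s2.lf.B₀ := by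
  have hB : (theta13OfThm1CCM F N jM ε₀ ε₂₉ B₃ B₃' a₀ a₁).s2.lf.B₀ = 1 := rfl
  rw [hB]; exact zero_le_one

end Signs

/-! ## §4 ★★★ THE K1⁷ v5 RUNG BODY AT THE DOOR-CURED PIN OF `θ₁₅ᶜᶜᴹ(jM)` (12T-H §2 instantiated; N12 by the mixed W-pin, N13 by dag-n11-e's v1.7 row) -/
section CuredThm1CCM
variable (jM : ℕ) (ε₀ ε₂₉ B₃ B₃' a₀ a₁ : ℝ) (lamW : ResidW F N)
  (Mstar : ℕ) (ops : OpsY N (theta13OfThm1CCM F N jM ε₀ ε₂₉ B₃ B₃' a₀ a₁).toStage3Params Mstar) (ζ : ResidZ F N) (W₀ : B12.RunParams → PrintedCarriers15) (w : WorldP)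

/-- **★★★ THE K1⁷ v5 RUNG BODY AT THE DOOR-CURED PIN OF THE COLLARED WITNESS `Stage13HParams.ofHistoryBlind F N (Stage13RParams.ofCured F N θ₁₅ᶜᶜᴹ(jM))`, N12 AND N13 RESOLVED** (12T-H §2 at
`Θ := theta13OfNumerics … (stage12NumericsOfThm1CCM F.L jM ε₀ B₃ B₃' a₀ a₁) …`, whose ₁₃ live re-pin IS `θ₁₅ᶜᶜᴹ(jM)` by `rfl`; K0b's residuals `hasResidualsOfRecord_theta13OfNumerics`, admissibility `admissible_theta13OfNumerics` under the six witness
signs via dag-n21-c's `stage12NumericsOfThm1CCM_pos` (`1 ≤ L`), the three term-constant signs by §3): K1⁷-SIDE INPUT = the v1.5 package `hP : Provisos₁₃SepCoP θ₁₅ᶜᶜᴹ(jM)` ALONE — verbatim the target of the R-keyed K0 closer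
`provisos₁₃SepCoP_theta13OfThm1CCM_of_thm1GaugeR` dag-n21-c announced for FILE B (INBOX l.21331) —; the world binding, rows h05S–h11 ∕ hUV, the layer `lamW` with `hsel`, the mixed W-pin and N12's per-run displays below the torus.  At
`N := 2` the conclusion IS the body of the plan's registered `NodesAtSomeRecord13PWS F` (`K1Skeleton13SepCoPHv5`, sha16 38c62055d1ac34a4; certificate of 12T-H).  COMPOSITE: nothing discharged as a node. [cite: Balaban1989LargeFieldII, Thm 1 p.355, (0.1) pp.355–356, p.387, p.391; Balaban1989LargeFieldI, (0.1) p.175, (0.2)–(0.6) p.176, p.177 (i)–(ii), Prop. 1 (1.78) p.194, (1.80) p.195, (1.89) p.198, (1.99)–(1.102) pp.200–201; Balaban1988Convergent, (1.11) p.248, p.244, Thm 1 p.262, (2.18) p.257, (3.16)–(3.25) pp.268–270; Balaban1985RegularSpaces, Lemma 1 – Thm 8 pp.79–101, Thm 8 (1.146) p.101 (surviving form), (1.3)–(1.6) p.77, Prop. 6 p.99 (witness letter); Balaban1985UV3, Thm 1 p.257, Thm 2 p.272; Balaban1985BackgroundPropagators, Thm 3.1 p.397; Balaban1985Variational, Thm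 1 p.279; Balaban1987RG1, Thm 1 p.259, Lemma 4 p.280; Balaban1988RG2Cluster, Lemmas 1–3 pp.9–20 (bookkeeping)] -/
theorem nodesAtSomeRecordS₁₃SepCoPH_of_upS_fourPinW₀_ofHistoryBlind_ofCured_theta13OfThm1CCM_of_massLive
    (hε : 0 < ε₀) (hε' : 0 < ε₂₉) (hB : 0 ≤ B₃) (hB' : 0 ≤ B₃') (ha₀ : 0 < a₀) (ha₁ : 0 < a₁)
    (hP : (theta13OfThm1CCM F N jM ε₀ ε₂₉ B₃ B₃' a₀ a₁).Provisos₁₃SepCoP F N)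
    (hW : ∀ P : B12.RunParams, lamW.kSel P < P.K → W₀ P = WOfRecord₁₃ F N (theta13OfThm1CCM F N jM ε₀ ε₂₉ B₃ B₃' a₀ a₁) lamW P) (hWdeg : ∀ P : B12.RunParams, P.K ≤ lamW.kSel P → B15Leaf (W₀ P))
    (hC : w.C = (datumOfRecord₁₃SepCoPH F N (Stage13HParams.ofHistoryBlind F N (Stage13RParams.ofCured F N (theta13OfThm1CCM F N jM ε₀ ε₂₉ B₃ B₃' a₀ a₁))) hP.ofCured.ofHistoryBlind).C) (hγ : 0 < w.γ ∧ w.γ ≤ (theta13OfThm1CCM F N jM ε₀ ε₂₉ B₃ B₃' a₀ a₁).γ) (hL : w.L = ((theta13OfThm1CCM F N jM ε₀ ε₂₉ B₃ B₃' a₀ a₁).L : ℝ))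
    (hup : ∀ P, w.up P = upOfRecord₅CS F N ((((((Stage13HParams.ofHistoryBlind F N (Stage13RParams.ofCured F N (theta13OfThm1CCM F N jM ε₀ ε₂₉ B₃ B₃' a₀ a₁))).toStage5₁₃CoPH F N).pinB10 F N).pinY F N (Y9OfRecord N (theta13OfThm1CCM F N jM ε₀ ε₂₉ B₃ B₃' a₀ a₁).toStage3Params Mstar ops)).pinZ F N (Z11OfRecord F N ζ)).pinW F N W₀) P)
    (h05S : ∀ P : B12.RunParams, (upOfRecord₅CS F N ((((((Stage13HParams.ofHistoryBlind F N (Stage13RParams.ofCured F N (theta13OfThm1CCM F N jM ε₀ ε₂₉ B₃ B₃' a₀ a₁))).toStage5₁₃CoPH F N).pinB10 F N).pinY F N (Y9OfRecord N (theta13OfThm1CCM F N jM ε₀ ε₂₉ B₃ B₃' a₀ a₁).toStage3Params Mstar ops)).pinZ F N (Z11OfRecord F N ζ)).pinW F N W₀) P).b8)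
    (h06 : B9LeafX (Y9OfRecord N (theta13OfThm1CCM F N jM ε₀ ε₂₉ B₃ B₃' a₀ a₁).toStage3Params Mstar ops))
    (h07 : B11Leaf (Z11OfRecord F N ζ))
    (h08 : PrintedUV3V N (theta13OfThm1CCM F N jM ε₀ ε₂₉ B₃ B₃' a₀ a₁).L)
    (h09 : ∀ P : B12.RunParams, B12Sec2to5.Lemma4Printed ((theta13OfThm1CCM F N jM ε₀ ε₂₉ B₃ B₃' a₀ a₁).res.X P).F12 ((theta13OfThm1CCM F N jM ε₀ ε₂₉ B₃ B₃' a₀ a₁).res.X P).c12)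
    (h09T : ∀ P : B12.RunParams, (leavesP w P).smallCouplings → (leavesP w P).smallFieldInductive)
    (h10 : ∀ P : B12.RunParams, B9LeafX (Y9OfRecord N (theta13OfThm1CCM F N jM ε₀ ε₂₉ B₃ B₃' a₀ a₁).toStage3Params Mstar ops) →
      (B10.Thm1PrintedCompact (((((((Stage13HParams.ofHistoryBlind F N (Stage13RParams.ofCured F N (theta13OfThm1CCM F N jM ε₀ ε₂₉ B₃ B₃' a₀ a₁))).toStage5₁₃CoPH F N).pinB10 F N).pinY F N (Y9OfRecord N (theta13OfThm1CCM F N jM ε₀ ε₂₉ B₃ B₃' a₀ a₁).toStage3Params Mstar ops)).pinZ F N (Z11OfRecord F N ζ)).pinW F N W₀).res.X P).runs10 ∧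
          B10.Thm2Printed (((((((Stage13HParams.ofHistoryBlind F N (Stage13RParams.ofCured F N (theta13OfThm1CCM F N jM ε₀ ε₂₉ B₃ B₃' a₀ a₁))).toStage5₁₃CoPH F N).pinB10 F N).pinY F N (Y9OfRecord N (theta13OfThm1CCM F N jM ε₀ ε₂₉ B₃ B₃' a₀ a₁).toStage3Params Mstar ops)).pinZ F N (Z11OfRecord F N ζ)).pinW F N W₀).res.X P).runs10) →
        B11Leaf (Z11OfRecord F N ζ) → B12Sec2to5.Lemma4Printed ((theta13OfThm1CCM F N jM ε₀ ε₂₉ B₃ B₃' a₀ a₁).res.X P).F12 ((theta13OfThm1CCM F N jM ε₀ ε₂₉ B₃ B₃' a₀ a₁).res.X P).c12 →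
          B13.Lemma1Printed ((theta13OfThm1CCM F N jM ε₀ ε₂₉ B₃ B₃' a₀ a₁).res.X P).S13 ((theta13OfThm1CCM F N jM ε₀ ε₂₉ B₃ B₃' a₀ a₁).res.X P).c13 ∧ B13.Lemma2Printed ((theta13OfThm1CCM F N jM ε₀ ε₂₉ B₃ B₃' a₀ a₁).res.X P).S13 ((theta13OfThm1CCM F N jM ε₀ ε₂₉ B₃ B₃' a₀ a₁).res.X P).c13 ∧
            B13.Lemma3Printed ((theta13OfThm1CCM F N jM ε₀ ε₂₉ B₃ B₃' a₀ a₁).res.X P).S13 ((theta13OfThm1CCM F N jM ε₀ ε₂₉ B₃ B₃' a₀ a₁).res.X P).c13)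
    (h11 : ∀ P : B12.RunParams, (leavesP w P).b7 → (leavesP w P).b8 → (leavesP w P).b9 → (leavesP w P).b10 → (leavesP w P).b11 →
      (leavesP w P).smallCouplings → (leavesP w P).smallFieldInductive → (leavesP w P).flowControl →
        ∀ k, k < P.K → SLaw₁₃CoPH F N (Stage13HParams.ofHistoryBlind F N (Stage13RParams.ofCured F N (theta13OfThm1CCM F N jM ε₀ ε₂₉ B₃ B₃' a₀ a₁))) P k → TLaw₁₃CoPH F N (Stage13HParams.ofHistoryBlind F N (Stage13RParams.ofCured F N (theta13OfThm1CCM F N jM ε₀ ε₂₉ B₃ B₃' a₀ a₁))) P k)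
    (hUV : ∀ P : B12.RunParams, (genFlow (betaOfRecord₁₃ F N (theta13OfThm1CCM F N jM ε₀ ε₂₉ B₃ B₃' a₀ a₁)) P.g0).InInterval w.γ P.K → ∀ k, k ≤ P.K → SLaw₁₃CoPH F N (Stage13HParams.ofHistoryBlind F N (Stage13RParams.ofCured F N (theta13OfThm1CCM F N jM ε₀ ε₂₉ B₃ B₃' a₀ a₁))) P k →
      ∀ U : GaugeField (F.P P.K) k (SU N),
        chiβOfRecord₁₃ F N (theta13OfThm1CCM F N jM ε₀ ε₂₉ B₃ B₃' a₀ a₁) P.K (gOfRecord₁₃ F N (theta13OfThm1CCM F N jM ε₀ ε₂₉ B₃ B₃' a₀ a₁) P) k U *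
              Real.exp (-(1 / (gOfRecord₁₃ F N (theta13OfThm1CCM F N jM ε₀ ε₂₉ B₃ B₃' a₀ a₁) P k) ^ 2 * wilsonBGOfRecord F N (theta13OfThm1CCM F N jM ε₀ ε₂₉ B₃ B₃' a₀ a₁).εbg P k U)
                - w.em (gOfRecord₁₃ F N (theta13OfThm1CCM F N jM ε₀ ε₂₉ B₃ B₃' a₀ a₁) P k) * (Fintype.card (Site (F.P P.K) k) : ℝ)) ≤ densOfRecord₁₃ F N (theta13OfThm1CCM F N jM ε₀ ε₂₉ B₃ B₃' a₀ a₁) P k U ∧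
        densOfRecord₁₃ F N (theta13OfThm1CCM F N jM ε₀ ε₂₉ B₃ B₃' a₀ a₁) P k U ≤ Real.exp (w.ep (gOfRecord₁₃ F N (theta13OfThm1CCM F N jM ε₀ ε₂₉ B₃ B₃' a₀ a₁) P k) * (Fintype.card (Site (F.P P.K) k) : ℝ)))
    (h12pin : ∀ P : B12.RunParams, lamW.kSel P < P.K → lamW.D1100 P
      = rPrimeDataOfSel (reprTOfRecord₁₃ F N (theta13OfThm1CCM F N jM ε₀ ε₂₉ B₃ B₃' a₀ a₁) P (lamW.kSel P))
          ((theta13OfThm1CCM F N jM ε₀ ε₂₉ B₃ B₃' a₀ a₁).ppSel P (gOfRecord₁₃ F N (theta13OfThm1CCM F N jM ε₀ ε₂₉ B₃ B₃' a₀ a₁) P) (lamW.kSel P + 1))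
          (fibOfSeq F (theta13OfThm1CCM F N jM ε₀ ε₂₉ B₃ B₃' a₀ a₁).ν (theta13OfThm1CCM F N jM ε₀ ε₂₉ B₃ B₃' a₀ a₁).τ9 P (gOfRecord₁₃ F N (theta13OfThm1CCM F N jM ε₀ ε₂₉ B₃ B₃' a₀ a₁) P) (lamW.kSel P + 1)))
    (h12mass : ∀ P : B12.RunParams, lamW.kSel P < P.K → ∀ s, LiveSeq F N (theta13OfThm1CCM F N jM ε₀ ε₂₉ B₃ B₃' a₀ a₁).ν (theta13OfThm1CCM F N jM ε₀ ε₂₉ B₃ B₃' a₀ a₁).τ9 P (gOfRecord₁₃ F N (theta13OfThm1CCM F N jM ε₀ ε₂₉ B₃ B₃' a₀ a₁) P) (lamW.kSel P + 1)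
        (slotsTOfRecord F N (theta13OfThm1CCM F N jM ε₀ ε₂₉ B₃ B₃' a₀ a₁).ν (theta13OfThm1CCM F N jM ε₀ ε₂₉ B₃ B₃' a₀ a₁).τ9 (EOfRecord₁₃ F N (theta13OfThm1CCM F N jM ε₀ ε₂₉ B₃ B₃' a₀ a₁)) (wOfRecord₉ F N (theta13OfThm1CCM F N jM ε₀ ε₂₉ B₃ B₃' a₀ a₁).toStage9Params)
          (theta13OfThm1CCM F N jM ε₀ ε₂₉ B₃ B₃' a₀ a₁).ppSel P (gOfRecord₁₃ F N (theta13OfThm1CCM F N jM ε₀ ε₂₉ B₃ B₃' a₀ a₁) P) (lamW.kSel P + 1)) s →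
      0 < ∫ V, rterm (reprTOfRecord₁₃ F N (theta13OfThm1CCM F N jM ε₀ ε₂₉ B₃ B₃' a₀ a₁) P (lamW.kSel P)) s V ∂(fieldMeasure (F.P P.K) (lamW.kSel P + 1) (SU N)))
    (h12P1 : ∀ P : B12.RunParams, lamW.kSel P < P.K → Prop1Printed (lamW.LF P))
    (h12i180 : ∀ P : B12.RunParams, lamW.kSel P < P.K → ∀ U, new189 (lamW.D189 P) U → ∀ i, (lamW.D189 P).h ≤ i → i ≤ (lamW.D189 P).k →
      ∀ q ∈ plaqsOf (dom (lamW.D189 P) i),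
        Ineq180 ((lamW.D189 P).dev0 U q) ((lamW.D189 P).ε (lamW.D189 P).k) (lamW.D189 P).η (lamW.D189 P).B₃ (lamW.D189 P).B₅ (lamW.D189 P).M (lamW.D189 P).δ
          ((lamW.D189 P).dist q) (lamW.D189 P).O1)
    (h12c189 : ∀ P : B12.RunParams, lamW.kSel P < P.K → Claim189 (new189 (lamW.D189 P)) (chiPP (lamW.D189 P)))
    (hsel : ∀ P : B12.RunParams, 1 ≤ P.K → lamW.kSel P < P.K) :
    ∃ (θ' : Stage13HParams F N) (h' : θ'.Provisos₁₃SepCoPH F N) (w : WorldP), (θ'.ZhUnity F N ∧ θ'.SlotsNondegenerate₁₃ F N) ∧ θ'.Admissible F N ∧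
      (∃ (θ'' : Stage13HParams F N) (h'' : θ''.Provisos₁₃SepCoPH F N), θ''.Admissible F N ∧
        datumOfRecord₁₃SepCoPH F N θ' h' = datumOfRecord₁₃SepCoPH F N θ'' h'' ∧ w.C = (datumOfRecord₁₃SepCoPH F N θ' h').C ∧ (0 < w.γ ∧ w.γ ≤ θ''.γ) ∧
        w.L = (θ''.L : ℝ) ∧ ∀ P : B12.RunParams, w.up P = upOfRecord₅CS F N (θ''.toStage5₁₃CoPH F N) P) ∧
      (∀ P : B12.RunParams, Nodes (leavesP w P)) ∧ PrintedUV3V N θ'.L ∧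
      ∃ lam : ResidW F N, (∀ P : B12.RunParams, 1 ≤ P.K → lam.kSel P < P.K) ∧
        ∀ P : B12.RunParams, lam.kSel P < P.K → ((leavesP w P).rBasicStep ↔ B15Leaf (WOfRecord₁₃ F N θ'.toStage13Params lam P)) :=
  nodesAtSomeRecordS₁₃SepCoPH_of_upS_fourPinW₀_ofHistoryBlind_ofCured_liveRepin₁₃_of_massLive_of_hasResiduals
    (theta13OfNumerics F N (stage12NumericsOfThm1CCM F.L jM ε₀ B₃ B₃' a₀ a₁) ε₂₉ (zeta316OfRecord F N (stage12NumericsOfThm1CCM F.L jM ε₀ B₃ B₃' a₀ a₁).ν (stage12NumericsOfThm1CCM F.L jM ε₀ B₃ B₃' a₀ a₁).τ9.M (stage12NumericsOfThm1CCM F.L jM ε₀ B₃ B₃' a₀ a₁).A₁) (RzOfRecord F N) (ZtOfRecord F N)) lamW Mstar ops ζ W₀ w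
    (hasResidualsOfRecord_theta13OfNumerics F N (stage12NumericsOfThm1CCM F.L jM ε₀ B₃ B₃' a₀ a₁) ε₂₉) hP
    (admissible_theta13OfNumerics F N (zeta316OfRecord F N (stage12NumericsOfThm1CCM F.L jM ε₀ B₃ B₃' a₀ a₁).ν (stage12NumericsOfThm1CCM F.L jM ε₀ B₃ B₃' a₀ a₁).τ9.M (stage12NumericsOfThm1CCM F.L jM ε₀ B₃ B₃' a₀ a₁).A₁) (RzOfRecord F N) (ZtOfRecord F N) (stage12NumericsOfThm1CCM_pos F.hL.2.le hε hB hB' ha₀ ha₁) hε')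
    (kappa_nonneg_theta13OfThm1CCM F N jM ε₀ ε₂₉ B₃ B₃' a₀ a₁) (E0_nonneg_theta13OfThm1CCM F N jM ε₀ ε₂₉ B₃ B₃' a₀ a₁) (B0_nonneg_theta13OfThm1CCM F N jM ε₀ ε₂₉ B₃ B₃' a₀ a₁)
    hW hWdeg hC hγ hL hup h05S h06 h07 h08 h09 h09T h10 h11 hUV h12pin h12mass h12P1 h12i180 h12c189 hsel

end CuredThm1CCM

/-! ## §5 ★★★ THE RUNG RESTRICTED TO N12 AT THE DOOR-CURED PIN OF `θ₁₅ᶜᶜᴹ(jM)` (12V-H §4 instantiated) -/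
section CuredThm1CCMOnly
variable (jM : ℕ) (ε₀ ε₂₉ B₃ B₃' a₀ a₁ : ℝ) (lamW : ResidW F N)

/-- **★★★ THE K1⁷ v5 RUNG RESTRICTED TO N12 AT THE DOOR-CURED PIN OF THE COLLARED WITNESS `θ₁₅ᶜᶜᴹ(jM)`** (12V-H §4 at `Θ := theta13OfNumerics … (stage12NumericsOfThm1CCM …) …`; K0b's residuals, admissibility and
`ZhUnity` theorems): K1⁷-SIDE INPUT = `hP : Provisos₁₃SepCoP θ₁₅ᶜᶜᴹ(jM)` ALONE; the layer `lamW`, its selector bound `hsel` and N12's per-run displays below the torus; the S-bound world is the MIXED W-PIN's (12V-H §2), so no `K = 0` run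
carries a [IV] demand.  The N12 line of the hourly WHICH-CHILD-BLOCKS table at the witness of record after (γ).  NOT the stub; count-neutral. [cite: Balaban1989LargeFieldII, Thm 1 p.355, (0.1) pp.355–356, p.391; Balaban1989LargeFieldI, (0.1) p.175, (0.2)–(0.6) p.176, p.177 (i)–(ii), Prop. 1 (1.78) p.194, (1.80) p.195, (1.89) p.198, (1.99)–(1.102) pp.200–201; Balaban1988Convergent, (1.11) p.248, (2.10) p.256, (3.16)–(3.25) pp.268–270; Balaban1985RegularSpaces, (1.3)–(1.6) p.77 (witness letter); Balaban1985Variational, Thm 1 p.279 (witness letters only)] -/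
theorem exists_guarded_recordS₁₃SepCoPH_b15_main_pinnedN12_ofHistoryBlind_ofCured_theta13OfThm1CCM_of_massLive (hε : 0 < ε₀) (hε' : 0 < ε₂₉) (hB : 0 ≤ B₃) (hB' : 0 ≤ B₃') (ha₀ : 0 < a₀) (ha₁ : 0 < a₁)
    (hP : (theta13OfThm1CCM F N jM ε₀ ε₂₉ B₃ B₃' a₀ a₁).Provisos₁₃SepCoP F N)
    (h12pin : ∀ P : B12.RunParams, lamW.kSel P < P.K → lamW.D1100 P
      = rPrimeDataOfSel (reprTOfRecord₁₃ F N (theta13OfThm1CCM F N jM ε₀ ε₂₉ B₃ B₃' a₀ a₁) P (lamW.kSel P))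
          ((theta13OfThm1CCM F N jM ε₀ ε₂₉ B₃ B₃' a₀ a₁).ppSel P (gOfRecord₁₃ F N (theta13OfThm1CCM F N jM ε₀ ε₂₉ B₃ B₃' a₀ a₁) P) (lamW.kSel P + 1))
          (fibOfSeq F (theta13OfThm1CCM F N jM ε₀ ε₂₉ B₃ B₃' a₀ a₁).ν (theta13OfThm1CCM F N jM ε₀ ε₂₉ B₃ B₃' a₀ a₁).τ9 P (gOfRecord₁₃ F N (theta13OfThm1CCM F N jM ε₀ ε₂₉ B₃ B₃' a₀ a₁) P) (lamW.kSel P + 1)))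
    (h12mass : ∀ P : B12.RunParams, lamW.kSel P < P.K → ∀ s, LiveSeq F N (theta13OfThm1CCM F N jM ε₀ ε₂₉ B₃ B₃' a₀ a₁).ν (theta13OfThm1CCM F N jM ε₀ ε₂₉ B₃ B₃' a₀ a₁).τ9 P (gOfRecord₁₃ F N (theta13OfThm1CCM F N jM ε₀ ε₂₉ B₃ B₃' a₀ a₁) P) (lamW.kSel P + 1)
        (slotsTOfRecord F N (theta13OfThm1CCM F N jM ε₀ ε₂₉ B₃ B₃' a₀ a₁).ν (theta13OfThm1CCM F N jM ε₀ ε₂₉ B₃ B₃' a₀ a₁).τ9 (EOfRecord₁₃ F N (theta13OfThm1CCM F N jM ε₀ ε₂₉ B₃ B₃' a₀ a₁)) (wOfRecord₉ F N (theta13OfThm1CCM F N jM ε₀ ε₂₉ B₃ B₃' a₀ a₁).toStage9Params)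
          (theta13OfThm1CCM F N jM ε₀ ε₂₉ B₃ B₃' a₀ a₁).ppSel P (gOfRecord₁₃ F N (theta13OfThm1CCM F N jM ε₀ ε₂₉ B₃ B₃' a₀ a₁) P) (lamW.kSel P + 1)) s →
      0 < ∫ V, rterm (reprTOfRecord₁₃ F N (theta13OfThm1CCM F N jM ε₀ ε₂₉ B₃ B₃' a₀ a₁) P (lamW.kSel P)) s V ∂(fieldMeasure (F.P P.K) (lamW.kSel P + 1) (SU N)))
    (h12P1 : ∀ P : B12.RunParams, lamW.kSel P < P.K → Prop1Printed (lamW.LF P))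
    (h12i180 : ∀ P : B12.RunParams, lamW.kSel P < P.K → ∀ U, new189 (lamW.D189 P) U → ∀ i, (lamW.D189 P).h ≤ i → i ≤ (lamW.D189 P).k →
      ∀ q ∈ plaqsOf (dom (lamW.D189 P) i),
        Ineq180 ((lamW.D189 P).dev0 U q) ((lamW.D189 P).ε (lamW.D189 P).k) (lamW.D189 P).η (lamW.D189 P).B₃ (lamW.D189 P).B₅ (lamW.D189 P).M (lamW.D189 P).δ
          ((lamW.D189 P).dist q) (lamW.D189 P).O1)
    (h12c189 : ∀ P : B12.RunParams, lamW.kSel P < P.K → Claim189 (new189 (lamW.D189 P)) (chiPP (lamW.D189 P)))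
    (hsel : ∀ P : B12.RunParams, 1 ≤ P.K → lamW.kSel P < P.K) :
    ∃ (θ' : Stage13HParams F N) (h' : θ'.Provisos₁₃SepCoPH F N) (w : WorldP), (θ'.ZhUnity F N ∧ θ'.SlotsNondegenerate₁₃ F N) ∧ θ'.Admissible F N ∧
      (∃ (θ'' : Stage13HParams F N) (h'' : θ''.Provisos₁₃SepCoPH F N), θ''.Admissible F N ∧
        datumOfRecord₁₃SepCoPH F N θ' h' = datumOfRecord₁₃SepCoPH F N θ'' h'' ∧ w.C = (datumOfRecord₁₃SepCoPH F N θ' h').C ∧ (0 < w.γ ∧ w.γ ≤ θ''.γ) ∧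
        w.L = (θ''.L : ℝ) ∧ ∀ P : B12.RunParams, w.up P = upOfRecord₅CS F N (θ''.toStage5₁₃CoPH F N) P) ∧
      (∀ P : B12.RunParams, Dag.B15_main (leavesP w P)) ∧
      ∃ lam : ResidW F N, (∀ P : B12.RunParams, 1 ≤ P.K → lam.kSel P < P.K) ∧
        ∀ P : B12.RunParams, lam.kSel P < P.K → ((leavesP w P).rBasicStep ↔ B15Leaf (WOfRecord₁₃ F N θ'.toStage13Params lam P)) :=
  exists_guarded_recordS₁₃SepCoPH_b15_main_pinnedN12_ofHistoryBlind_ofCured_liveRepin₁₃_of_massLive_of_hasResiduals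
    (theta13OfNumerics F N (stage12NumericsOfThm1CCM F.L jM ε₀ B₃ B₃' a₀ a₁) ε₂₉
      (zeta316OfRecord F N (stage12NumericsOfThm1CCM F.L jM ε₀ B₃ B₃' a₀ a₁).ν (stage12NumericsOfThm1CCM F.L jM ε₀ B₃ B₃' a₀ a₁).τ9.M (stage12NumericsOfThm1CCM F.L jM ε₀ B₃ B₃' a₀ a₁).A₁)
      (RzOfRecord F N) (ZtOfRecord F N)) lamW
    (hasResidualsOfRecord_theta13OfNumerics F N (stage12NumericsOfThm1CCM F.L jM ε₀ B₃ B₃' a₀ a₁) ε₂₉) hP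
    (admissible_theta13OfNumerics F N (zeta316OfRecord F N (stage12NumericsOfThm1CCM F.L jM ε₀ B₃ B₃' a₀ a₁).ν (stage12NumericsOfThm1CCM F.L jM ε₀ B₃ B₃' a₀ a₁).τ9.M
      (stage12NumericsOfThm1CCM F.L jM ε₀ B₃ B₃' a₀ a₁).A₁) (RzOfRecord F N) (ZtOfRecord F N) (stage12NumericsOfThm1CCM_pos F.hL.2.le hε hB hB' ha₀ ha₁) hε')
    h12pin h12mass h12P1 h12i180 h12c189 hsel

end CuredThm1CCMOnly

end Summit.QuantumFields.YangMills.BalabanUVNodes.N12AtTheta13OfThm1CCM
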